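import Literature.Combinatorics.Sahi2008.Multilinear
import Literature.Combinatorics.Sahi2008.Symmetry
import HarnessLib

/-!
# `NoHeavyLowerTail` (crux stmt-CriticalPhenomena-4575), Sahi programme: two tools for the all-orders tangent inequality —
# **a nonnegative slot disjoint from the product of the other slots makes `E_n` nonpositive**, and the coin space `Bool × α`

Support file (Sahi cell, seat `prim-sahi-p1`, generation 47; `--supports stmt-CriticalPhenomena-4575`); part 1 of 2 (part 2:
`…SahiTangentAllOrders`, the contraction / tangent inequality `E_n^{B_p⊗μ}(F) ≥ p·E_n^{μ}(F|top)` at every order).  Pure proofs, NO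
definitions, no `sorry`, standard axioms.  Vocabulary: `sahiE`, `ex`, `SahiPositive` of `Literature/Combinatorics/Sahi2008`; the coin-product
weight on `Bool × α` is written, as in `…SahiTangentChain` (prim-sahi-p2 gen 32), `B_p ⊗ μ = fun z => if z.1 then p * μ z.2 else (1 - p) * μ z.2`.

THE MATHEMATICS.
* `sahiE_nonpos_of_prod_eq_zero` (**Lemma D**): for a weight `ρ ≥ 0` on a finite preorder, Sahi-positive of every order, ANY function
  `f_0 ≥ 0` and monotone `f_1,…,f_{n+1} ≥ 0` with `f_0·f_1⋯f_{n+1} ≡ 0`:  `E_{n+2}(f_0,…,f_{n+1}) ≤ 0`.  Induction through the Lieb–Sahi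
  recursion `E_{n+2}(f_0; g) = Σ_i E_{n+1}(g[i ← g_i f_0]) − E(f_0)·E_{n+1}(g)`: each `g_i f_0` is again nonnegative and disjoint from the
  product of the remaining slots, and `E_{n+1}(g) ≥ 0`; at the bottom `E_2(f_0,f_1) = −E f_0·E f_1`.  (Moment reading: `E_n` is linear in the
  moments through slot `0` with coefficients `−(|B|−1)!·E_{n−|B|}(f|_{B^c}) ≤ 0` for `B ≠ [n]`, and the top moment vanishes.)
  `sahiE_nonpos_of_prod_eq_zero'`: the same with the disjoint function in an arbitrary slot.
* Coin bookkeeping on `Bool × α` (any real `p`): `sahiE_coin_snd` — functions of the `α`-coordinate only have `E_n^{B_p⊗μ} = E_n^{μ}`;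
  `sahiE_coin_top` — if slot `j` holds `ε·g` (the function `g` on the top layer, `0` below) and the other slots are functions of `x`, then
  `E_n^{B_p⊗μ} = p·E_n^{μ}(…, g, …)` (induction through the recursion, slot `j` arbitrary).
Nothing conjectural is asserted. [this work]
-/

namespace Summit.CriticalPhenomena.PercolationContinuityZ3.Theorems.SahiTangent

open Finset Function Literature.Combinatorics.Sahi2008
open scoped BigOperators

/-! ### Lemma D: a nonnegative slot disjoint from the product of the others makes `E_n` nonpositive -/

section DisjointSlot

variable {β : Type*} [Fintype β] [Preorder β]

/-- **A disjoint slot is nonpositive.**  Let `ρ ≥ 0` be a weight on a finite preorder that is Sahi-positive of every order,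
`f_0 ≥ 0` ANY function and `f_1,…,f_{n+1} ≥ 0` monotone, with `f_0 · f_1 ⋯ f_{n+1} ≡ 0`.  Then `E_{n+2}(f_0,…,f_{n+1}) ≤ 0`.
(Induction on `n` through the Lieb–Sahi recursion: every term `E_{n+1}(…, f_i f_0, …)` has the same shape one order down,
and the last term is `−E_{n+1}(f_1,…)·E f_0 ≤ 0`; at `n = 0`, `E_2(f_0,f_1) = −E f_0 · E f_1`.) [this work] -/
theorem sahiE_nonpos_of_prod_eq_zero {ρ : β → ℝ} (hρ₀ : ∀ x, 0 ≤ ρ x) (hpos : ∀ k, SahiPositive ρ k) :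
    ∀ (n : ℕ) (f : Fin (n + 2) → β → ℝ), (∀ x, 0 ≤ f 0 x) → (∀ i : Fin (n + 1), ∀ x, 0 ≤ f i.succ x) →
      (∀ i : Fin (n + 1), Monotone (f i.succ)) → (∀ x, ∏ i, f i x = 0) → sahiE ρ (n + 2) f ≤ 0 := by
  intro n
  induction n with
  | zero =>
    intro f h0 hs0 _ hprod
    rw [sahiE_succ_succ]
    have h1 : ∀ i : Fin 1, sahiE ρ 1 (update (Fin.tail f) i (Fin.tail f i * f 0)) = 0 := by
      intro i
      have hi : i = 0 := Subsingleton.elim i 0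
      subst hi
      rw [sahiE_one_apply, update_self, ex]
      refine Finset.sum_eq_zero fun x _ => ?_
      have hx := hprod x
      rw [Fin.prod_univ_succ, Fin.prod_univ_one] at hx
      show ρ x * (f (Fin.succ 0) x * f 0 x) = 0
      rw [mul_comm (f (Fin.succ 0) x), hx, mul_zero]
    have h2 : 0 ≤ sahiE ρ 1 (Fin.tail f) * ex ρ (f 0) := by
      rw [sahiE_one_apply]
      exact mul_nonneg (ex_nonneg hρ₀ (hs0 0)) (ex_nonneg hρ₀ h0)
    rw [Finset.sum_eq_zero fun i _ => h1 i]
    linarith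
  | succ m ih =>
    intro f h0 hs0 hsm hprod
    rw [sahiE_succ_succ]
    have hterm : ∀ i : Fin (m + 2), sahiE ρ (m + 2) (update (Fin.tail f) i (Fin.tail f i * f 0)) ≤ 0 := by
      intro i
      set g : Fin (m + 2) → β → ℝ := update (Fin.tail f) i (Fin.tail f i * f 0) with hg
      let σ : Equiv.Perm (Fin (m + 2)) := Equiv.swap 0 i
      have hσ0 : σ 0 = i := Equiv.swap_apply_left 0 i
      have hσs : ∀ k : Fin (m + 1), σ k.succ ≠ i := by
        intro k hk
        have h' := congrArg σ hk
        rw [Equiv.swap_apply_self, Equiv.swap_apply_right] at h'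
        exact Fin.succ_ne_zero k h'
      rw [← sahiE_comp_perm ρ (m + 2) σ g]
      refine ih (fun k => g (σ k)) ?_ ?_ ?_ ?_
      · intro x
        show 0 ≤ g (σ 0) x
        rw [hσ0, hg, update_self]
        exact mul_nonneg (hs0 i x) (h0 x)
      · intro k x
        show 0 ≤ g (σ k.succ) x
        rw [hg, update_of_ne (hσs k)]
        exact hs0 _ x
      · intro k
        show Monotone (g (σ k.succ))
        rw [hg, update_of_ne (hσs k)]
        exact hsm _
      · intro x
        have e1 : (∏ k : Fin (m + 2), g (σ k) x) = ∏ l : Fin (m + 2), g l x :=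
          Equiv.prod_comp σ (fun l => g l x)
        rw [e1, Fin.prod_univ_succAbove _ i]
        have e2 : g i x = Fin.tail f i x * f 0 x := by rw [hg, update_self]; rfl
        have e3 : ∀ k : Fin (m + 1), g (i.succAbove k) x = Fin.tail f (i.succAbove k) x := by
          intro k; rw [hg, update_of_ne (Fin.succAbove_ne i k)]
        simp_rw [e2, e3]
        have hx := hprod x
        rw [Fin.prod_univ_succ, Fin.prod_univ_succAbove _ i] at hx
        -- hx : f 0 x * (f i.succ x * ∏ k, f (i.succAbove k).succ x) = 0
        have e4 : ∀ l : Fin (m + 2), Fin.tail f l x = f l.succ x := fun l => rfl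
        simp_rw [e4]
        linear_combination hx
    have hlast : 0 ≤ sahiE ρ (m + 2) (Fin.tail f) * ex ρ (f 0) :=
      mul_nonneg (hpos (m + 2) _ hs0 hsm) (ex_nonneg hρ₀ h0)
    have hsum : (∑ i : Fin (m + 2), sahiE ρ (m + 2) (update (Fin.tail f) i (Fin.tail f i * f 0))) ≤ 0 :=
      Finset.sum_nonpos fun i _ => hterm i
    linarith

/-- **Arbitrary slot.**  Same, with the disjoint (not necessarily monotone) function in slot `i` and the other slots monotone
nonnegative. [this work] -/
theorem sahiE_nonpos_of_prod_eq_zero' {ρ : β → ℝ} (hρ₀ : ∀ x, 0 ≤ ρ x) (hpos : ∀ k, SahiPositive ρ k)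
    {n : ℕ} (f : Fin (n + 2) → β → ℝ) (i : Fin (n + 2)) (hi0 : ∀ x, 0 ≤ f i x)
    (h0 : ∀ l, l ≠ i → ∀ x, 0 ≤ f l x) (hm : ∀ l, l ≠ i → Monotone (f l)) (hprod : ∀ x, ∏ l, f l x = 0) :
    sahiE ρ (n + 2) f ≤ 0 := by
  let σ : Equiv.Perm (Fin (n + 2)) := Equiv.swap 0 i
  have hσ0 : σ 0 = i := Equiv.swap_apply_left 0 i
  have hσs : ∀ k : Fin (n + 1), σ k.succ ≠ i := by
    intro k hk
    have h' := congrArg σ hk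
    rw [Equiv.swap_apply_self, Equiv.swap_apply_right] at h'
    exact Fin.succ_ne_zero k h'
  rw [← sahiE_comp_perm ρ (n + 2) σ f]
  refine sahiE_nonpos_of_prod_eq_zero hρ₀ hpos n (fun k => f (σ k)) ?_ ?_ ?_ ?_
  · intro x; show 0 ≤ f (σ 0) x; rw [hσ0]; exact hi0 x
  · intro k x; exact h0 _ (hσs k) x
  · intro k; exact hm _ (hσs k)
  · intro x
    rw [Equiv.prod_comp σ (fun l => f l x)]
    exact hprod x

end DisjointSlot

/-! ### The coin space `Bool × α` with the product weight `B_p ⊗ μ`: bookkeeping -/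

section Coin

variable {α : Type*} [Fintype α]

/-- The `α`-marginal of the coin product: `E_{B_p⊗μ}(H ∘ snd) = E_μ H` (any real `p`). [this work] -/
theorem ex_coin_snd (μ : α → ℝ) (p : ℝ) (H : α → ℝ) :
    ex (fun z : Bool × α => if z.1 then p * μ z.2 else (1 - p) * μ z.2) (fun z => H z.2) = ex μ H := by
  simp only [ex, Fintype.sum_prod_type, Fintype.sum_bool, if_true, Bool.false_eq_true, if_false, ← Finset.sum_add_distrib]
  refine Finset.sum_congr rfl fun x _ => ?_
  ring

/-- A function living on the top layer: `E_{B_p⊗μ}(ε·G∘snd) = p·E_μ G`. [this work] -/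
theorem ex_coin_top (μ : α → ℝ) (p : ℝ) (G : α → ℝ) :
    ex (fun z : Bool × α => if z.1 then p * μ z.2 else (1 - p) * μ z.2) (fun z => if z.1 then G z.2 else 0) = p * ex μ G := by
  simp only [ex, Fintype.sum_prod_type, Fintype.sum_bool, if_true, Bool.false_eq_true, if_false, mul_zero,
    Finset.sum_const_zero, add_zero, Finset.mul_sum]
  refine Finset.sum_congr rfl fun x _ => ?_
  ring

omit [Fintype α] in
/-- Lifting commutes with `update` (bookkeeping). [this work] -/
theorem lift_update {n : ℕ} (h : Fin n → α → ℝ) (j : Fin n) (g : α → ℝ) :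
    (fun i (z : Bool × α) => update h j g i z.2) = update (fun i (z : Bool × α) => h i z.2) j (fun z => g z.2) := by
  funext i z
  by_cases hij : i = j
  · subst hij; simp only [update_self]
  · simp only [update_of_ne hij]

/-- **Marginalisation**: for a family of functions of the `α`-coordinate only, `E_n^{B_p⊗μ}(h ∘ snd) = E_n^{μ}(h)` (any real `p`).
[this work] -/
theorem sahiE_coin_snd (μ : α → ℝ) (p : ℝ) : ∀ (n : ℕ) (h : Fin n → α → ℝ),
    sahiE (fun z : Bool × α => if z.1 then p * μ z.2 else (1 - p) * μ z.2) n (fun i z => h i z.2) = sahiE μ n h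
  | 0, h => by rw [sahiE_zero, sahiE_zero]
  | 1, h => by rw [sahiE_one_apply, sahiE_one_apply]; exact ex_coin_snd μ p (h 0)
  | n + 2, h => by
    rw [sahiE_succ_succ, sahiE_succ_succ, ex_coin_snd]
    have htail : Fin.tail (fun i (z : Bool × α) => h i z.2) = fun i (z : Bool × α) => Fin.tail h i z.2 := rfl
    simp only [htail]
    rw [sahiE_coin_snd μ p (n + 1) (Fin.tail h)]
    congr 1
    refine Finset.sum_congr rfl fun i _ => ?_
    have e : update (fun k (z : Bool × α) => Fin.tail h k z.2) i ((fun k (z : Bool × α) => Fin.tail h k z.2) i * fun z => h 0 z.2) =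
        fun k (z : Bool × α) => update (Fin.tail h) i (Fin.tail h i * h 0) k z.2 := by
      rw [lift_update]
      rfl
    rw [e, sahiE_coin_snd μ p (n + 1)]

/-- **Scaling of a top-layer slot**: if slot `j` holds `ε·g` (the function `g` on the top layer, `0` below) and all other slots hold
functions of the `α`-coordinate, then `E_n^{B_p⊗μ} = p · E_n^{μ}(…, g, …)` (any real `p`): every mixed moment through slot `j`
is `p` times the corresponding `μ`-moment, and `E_n` is linear in the moments through a fixed slot. [this work] -/
theorem sahiE_coin_top (μ : α → ℝ) (p : ℝ) : ∀ (n : ℕ) (h : Fin n → α → ℝ) (j : Fin n) (g : α → ℝ),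
    sahiE (fun z : Bool × α => if z.1 then p * μ z.2 else (1 - p) * μ z.2) n
        (update (fun i (z : Bool × α) => h i z.2) j (fun z => if z.1 then g z.2 else 0)) =
      p * sahiE μ n (update h j g)
  | 0, _, j, _ => j.elim0
  | 1, h, j, g => by
    have hj : j = 0 := Subsingleton.elim j 0
    subst hj
    rw [sahiE_one_apply, sahiE_one_apply, update_self, update_self]
    exact ex_coin_top μ p g
  | n + 2, h, j, g => by
    -- abbreviations
    have top_mul : ∀ (g' H : α → ℝ), ((fun z : Bool × α => if z.1 then g' z.2 else 0) * fun z : Bool × α => H z.2) =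
        fun z : Bool × α => if z.1 then (g' * H) z.2 else 0 := by
      intro g' H; funext z
      rcases z with ⟨b, x⟩
      cases b <;> simp
    have mul_top : ∀ (g' H : α → ℝ), ((fun z : Bool × α => H z.2) * fun z : Bool × α => if z.1 then g' z.2 else 0) =
        fun z : Bool × α => if z.1 then (H * g') z.2 else 0 := by
      intro g' H; funext z
      rcases z with ⟨b, x⟩
      cases b <;> simp
    induction j using Fin.cases with
    | zero =>
      rw [sahiE_succ_succ, sahiE_succ_succ, update_self, update_self, Fin.tail_update_zero, Fin.tail_update_zero, ex_coin_top,
        mul_sub, Finset.mul_sum]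
      have htail : Fin.tail (fun i (z : Bool × α) => h i z.2) = fun i (z : Bool × α) => Fin.tail h i z.2 := rfl
      rw [htail, sahiE_coin_snd μ p (n + 1)]
      congr 1
      · refine Finset.sum_congr rfl fun i _ => ?_
        have e : update (fun k (z : Bool × α) => Fin.tail h k z.2) i
            ((fun k (z : Bool × α) => Fin.tail h k z.2) i * fun z : Bool × α => if z.1 then g z.2 else 0) =
            update (fun k (z : Bool × α) => Fin.tail h k z.2) i (fun z : Bool × α => if z.1 then (Fin.tail h i * g) z.2 else 0) := by
          rw [mul_top]
        rw [e, sahiE_coin_top μ p (n + 1) (Fin.tail h) i]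
      · ring
    | succ k =>
      have hne : (k.succ : Fin (n + 2)) ≠ 0 := Fin.succ_ne_zero k
      rw [sahiE_succ_succ, sahiE_succ_succ, update_of_ne hne.symm, update_of_ne hne.symm, Fin.tail_update_succ,
        Fin.tail_update_succ, ex_coin_snd, mul_sub, Finset.mul_sum]
      have htail : Fin.tail (fun i (z : Bool × α) => h i z.2) = fun i (z : Bool × α) => Fin.tail h i z.2 := rfl
      rw [htail, sahiE_coin_top μ p (n + 1) (Fin.tail h) k g]
      congr 1
      · refine Finset.sum_congr rfl fun i _ => ?_
        by_cases hik : i = k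
        · subst hik
          rw [update_self, update_self, update_idem, update_idem, top_mul]
          show sahiE _ (n + 1) (update (fun i (z : Bool × α) => Fin.tail h i z.2) i
              (fun z : Bool × α => if z.1 then (g * h 0) z.2 else 0)) = p * sahiE μ (n + 1) (update (Fin.tail h) i (g * h 0))
          exact sahiE_coin_top μ p (n + 1) (Fin.tail h) i (g * h 0)
        · rw [update_of_ne hik, update_of_ne hik, update_comm (Ne.symm hik), update_comm (Ne.symm hik)]
          have e : update (fun i (z : Bool × α) => Fin.tail h i z.2) i ((fun i (z : Bool × α) => Fin.tail h i z.2) i * fun z => h 0 z.2) =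
              fun l (z : Bool × α) => update (Fin.tail h) i (Fin.tail h i * h 0) l z.2 := by
            rw [lift_update]; rfl
          rw [e, sahiE_coin_top μ p (n + 1) (update (Fin.tail h) i (Fin.tail h i * h 0)) k g]
      · ring

end Coin

end Summit.CriticalPhenomena.PercolationContinuityZ3.Theorems.SahiTangent
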